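import Mathlib
import HarnessLib
import Summits.Ventures.LatticeQCDFlow.Exactness.SU3AlcoveCover
import Summits.Ventures.LatticeQCDFlow.Exactness.TorusCubeFundamentalDomain

/-!
# The six Weyl chambers of the `SU(3)` alcove form a fundamental domain of the angle lattice: `Leb(S ∩ (−π,π]²) = Σ_{τ ∈ S₃} Leb(S ∩ C_τ)` for lattice-invariant `S`

HONEST FRAMING: exact (Metropolis-corrected) sampling algorithms for lattice gauge theory;
figures of merit are autocorrelation/cost numbers at stated couplings and volumes; no
continuum-physics claim.

Venture `LatticeQCDFlow` (cell pub-lqcd), topic `Exactness`; FANOUT row 10 (`eng-equiv`, engine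
`latflow.equiv` `spectral.py`, `N = 3`: the free eigen-phases `θ = (x₁, x₂)` (`x₃ = −x₁ − x₂`)
returned in the cube `(−π, π]²` are moved by Algorithm 1 into the cell `x₁ < x₂ < x₃ < x₁ + 2π`
up to a remembered permutation).  NEW WORK of the cell over this row's `SU3AlcoveCover.lean`
(Algorithm 1: existence / uniqueness of the lattice shift, uniqueness of the chamber) and
`TorusCubeFundamentalDomain.lean` (the cube is a fundamental domain; `measure_set_eq`), and Mathlib
(`IsAddFundamentalDomain.mk''`, `Real.map_matrix_volume_pi_eq_smul_volume_pi`,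
`Measure.pi_hyperplane`).  Nothing is cited as a fact; no number; no definition (the chambers
enter through the characterising hypothesis `hC`).  Step 2b (measure half, angle side) of the
`N = 3` alcove programme (LEANMAP-eng-equiv-gen8 §C′).

## What is typed (`x(θ) = (θ₀, θ₁, −θ₀−θ₁)`; chamber `C τ = {θ | x(θ)(τ0) < x(θ)(τ1) < x(θ)(τ2) < x(θ)(τ0) + 2π}`,
`τ ∈ S₃`; `C 1` is the alcove in free eigen-phases; lattice `(2πℤ)²`)

* `volume_line_eq_zero` — a line `{a θ₀ + b θ₁ = c}`, `a ≠ 0`, is Lebesgue-null;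
  **`volume_walls_su3_eq_zero`** — the walls `{x_i − x_j ∈ 2πℤ, i ≠ j}` are null;
* `measurableSet_chamber_su3`, **`pairwise_disjoint_chambers_su3`**;
* **`isAddFundamentalDomain_chambers_su3`** — `⋃_τ C τ` is a fundamental domain of `(2πℤ)²` acting
  on `ℝ²` by translation (cover a.e. = Algorithm 1 off the walls; disjoint translates = uniqueness
  of the lattice shift);
* **`volume_inter_cube_eq_sum_chambers_su3`** — for every measurable `(2πℤ)²`-invariant `S ⊆ ℝ²`:
  `Leb(S ∩ (−π, π]²) = Σ_{τ ∈ S₃} Leb(S ∩ C τ)`.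

NOT here: the torus `SΔ(3)` and its Haar measure (`SU3TorusChamberDecomposition.lean`); any number.
-/

noncomputable section

namespace Summit.Ventures.LatticeQCDFlow.Exactness

open MeasureTheory Set Real

/-! ## The three phases of a pair of free phases -/

/-- The three eigen-phases `(θ₀, θ₁, −θ₀−θ₁)` sum to zero. -/
theorem sum_phases_su3 (θ : Fin 2 → ℝ) : ∑ i, (![θ 0, θ 1, -(θ 0 + θ 1)] : Fin 3 → ℝ) i = 0 := by
  rw [Fin.sum_univ_three]
  simp

/-- The three eigen-phases depend continuously on the free phases. -/
theorem continuous_phases_su3 : Continuous fun θ : Fin 2 → ℝ => (![θ 0, θ 1, -(θ 0 + θ 1)] : Fin 3 → ℝ) := by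
  have h0 : Continuous fun θ : Fin 2 → ℝ => θ 0 := continuous_apply 0
  have h1 : Continuous fun θ : Fin 2 → ℝ => θ 1 := continuous_apply 1
  have h2 : Continuous fun θ : Fin 2 → ℝ => -(θ 0 + θ 1) := (h0.add h1).neg
  refine continuous_pi fun i => ?_
  fin_cases i
  · simpa using h0
  · simpa using h1
  · simpa using h2

/-- **An integer translation of the free phases shifts the three eigen-phases by the sum-zero
integer vector `(m₀, m₁, −m₀−m₁)` times `2π`.** -/
theorem phases_su3_intMul_add (m : Fin 2 → ℤ) (θ : Fin 2 → ℝ) (i : Fin 3) :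
    (![((fun k => (m k : ℝ) * (2 * π)) + θ) 0, ((fun k => (m k : ℝ) * (2 * π)) + θ) 1,
        -(((fun k => (m k : ℝ) * (2 * π)) + θ) 0 + ((fun k => (m k : ℝ) * (2 * π)) + θ) 1)] : Fin 3 → ℝ) i =
      (![θ 0, θ 1, -(θ 0 + θ 1)] : Fin 3 → ℝ) i + ((![m 0, m 1, -(m 0 + m 1)] : Fin 3 → ℤ) i : ℝ) * (2 * π) := by
  fin_cases i
  · simp; ring
  · simp; ring
  · simp; ring

/-- The sum-zero integer vector of an integer translation. -/
theorem sum_intVec_su3 (m : Fin 2 → ℤ) : ∑ i, (![m 0, m 1, -(m 0 + m 1)] : Fin 3 → ℤ) i = 0 := by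
  rw [Fin.sum_univ_three]
  simp

/-! ## Null lines and the walls -/

/-- **A line with `a ≠ 0` is Lebesgue-null in the plane**: `Leb{θ | a θ₀ + b θ₁ = c} = 0` (it is the
preimage of the coordinate hyperplane `{y₀ = c}` under the invertible linear map `(θ₀, θ₁) ↦
(a θ₀ + b θ₁, θ₁)`, which rescales Lebesgue measure). -/
theorem volume_line_eq_zero (a b c : ℝ) (ha : a ≠ 0) :
    volume {θ : Fin 2 → ℝ | a * θ 0 + b * θ 1 = c} = 0 := by
  have hdet : (Matrix.of ![![a, b], ![0, 1]] : Matrix (Fin 2) (Fin 2) ℝ).det ≠ 0 := by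
    rw [Matrix.det_fin_two_of]
    simpa using ha
  have hmap := Real.map_matrix_volume_pi_eq_smul_volume_pi hdet
  have hpre : {θ : Fin 2 → ℝ | a * θ 0 + b * θ 1 = c} =
      (Matrix.toLin' (Matrix.of ![![a, b], ![0, 1]] : Matrix (Fin 2) (Fin 2) ℝ)) ⁻¹'
        {y : Fin 2 → ℝ | y 0 = c} := by
    ext θ
    simp [Matrix.toLin'_apply, Matrix.mulVec, dotProduct, Fin.sum_univ_two]
  have hH : MeasurableSet {y : Fin 2 → ℝ | y 0 = c} :=
    measurableSet_eq_fun (measurable_pi_apply 0) measurable_const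
  have hH0 : volume {y : Fin 2 → ℝ | y 0 = c} = 0 := by
    rw [volume_pi]
    exact Measure.pi_hyperplane (fun _ : Fin 2 => (volume : Measure ℝ)) (0 : Fin 2) c
  rw [hpre, ← Measure.map_apply (Matrix.toLin' _).continuous_of_finiteDimensional.measurable hH, hmap,
    Measure.smul_apply, hH0, smul_zero]

/-- The difference of two distinct eigen-phases is a linear form in the free phases with a nonzero
first coefficient. -/
theorem exists_lineCoeffs_phases_su3 (i j : Fin 3) (hij : i ≠ j) :
    ∃ a b : ℝ, a ≠ 0 ∧ ∀ θ : Fin 2 → ℝ,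
      (![θ 0, θ 1, -(θ 0 + θ 1)] : Fin 3 → ℝ) i - (![θ 0, θ 1, -(θ 0 + θ 1)] : Fin 3 → ℝ) j = a * θ 0 + b * θ 1 := by
  fin_cases i <;> fin_cases j
  · exact absurd rfl hij
  · exact ⟨1, -1, one_ne_zero, fun θ => by simp; ring⟩
  · exact ⟨2, 1, two_ne_zero, fun θ => by simp; ring⟩
  · exact ⟨-1, 1, by norm_num, fun θ => by simp; ring⟩
  · exact absurd rfl hij
  · exact ⟨1, 2, one_ne_zero, fun θ => by simp; ring⟩
  · exact ⟨-2, -1, by norm_num, fun θ => by simp; ring⟩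
  · exact ⟨-1, -2, by norm_num, fun θ => by simp; ring⟩
  · exact absurd rfl hij

/-- **The walls are Lebesgue-null**: the set of free phases for which two of the three eigen-phases
differ by an integer multiple of `2π` (a degenerate spectrum) has measure zero. -/
theorem volume_walls_su3_eq_zero :
    volume {θ : Fin 2 → ℝ | ∃ i j : Fin 3, i ≠ j ∧ ∃ k : ℤ,
      (![θ 0, θ 1, -(θ 0 + θ 1)] : Fin 3 → ℝ) i - (![θ 0, θ 1, -(θ 0 + θ 1)] : Fin 3 → ℝ) j = k * (2 * π)} = 0 := by
  have hsub : {θ : Fin 2 → ℝ | ∃ i j : Fin 3, i ≠ j ∧ ∃ k : ℤ,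
      (![θ 0, θ 1, -(θ 0 + θ 1)] : Fin 3 → ℝ) i - (![θ 0, θ 1, -(θ 0 + θ 1)] : Fin 3 → ℝ) j = k * (2 * π)} ⊆
      ⋃ i : Fin 3, ⋃ j : Fin 3, ⋃ k : ℤ, {θ : Fin 2 → ℝ | i ≠ j ∧
        (![θ 0, θ 1, -(θ 0 + θ 1)] : Fin 3 → ℝ) i - (![θ 0, θ 1, -(θ 0 + θ 1)] : Fin 3 → ℝ) j = k * (2 * π)} := by
    rintro θ ⟨i, j, hij, k, hk⟩
    simp only [Set.mem_iUnion, Set.mem_setOf_eq]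
    exact ⟨i, j, k, hij, hk⟩
  refine measure_mono_null hsub ?_
  refine measure_iUnion_null fun i => measure_iUnion_null fun j => measure_iUnion_null fun k => ?_
  by_cases hij : i = j
  · have hempty : {θ : Fin 2 → ℝ | i ≠ j ∧
        (![θ 0, θ 1, -(θ 0 + θ 1)] : Fin 3 → ℝ) i - (![θ 0, θ 1, -(θ 0 + θ 1)] : Fin 3 → ℝ) j = k * (2 * π)} = ∅ := by
      ext θ
      simp [hij]
    rw [hempty, measure_empty]
  · obtain ⟨a, b, ha, hab⟩ := exists_lineCoeffs_phases_su3 i j hij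
    have hset : {θ : Fin 2 → ℝ | i ≠ j ∧
        (![θ 0, θ 1, -(θ 0 + θ 1)] : Fin 3 → ℝ) i - (![θ 0, θ 1, -(θ 0 + θ 1)] : Fin 3 → ℝ) j = k * (2 * π)} =
        {θ : Fin 2 → ℝ | a * θ 0 + b * θ 1 = k * (2 * π)} := by
      ext θ
      simp only [Set.mem_setOf_eq, ne_eq, hij, not_false_eq_true, true_and, hab θ]
    rw [hset]
    exact volume_line_eq_zero a b _ ha

/-! ## The chambers -/

section Chambers

variable {C : Equiv.Perm (Fin 3) → Set (Fin 2 → ℝ)}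
  (hC : ∀ τ θ, θ ∈ C τ ↔
    (![θ 0, θ 1, -(θ 0 + θ 1)] : Fin 3 → ℝ) (τ 0) < (![θ 0, θ 1, -(θ 0 + θ 1)] : Fin 3 → ℝ) (τ 1) ∧
      (![θ 0, θ 1, -(θ 0 + θ 1)] : Fin 3 → ℝ) (τ 1) < (![θ 0, θ 1, -(θ 0 + θ 1)] : Fin 3 → ℝ) (τ 2) ∧
        (![θ 0, θ 1, -(θ 0 + θ 1)] : Fin 3 → ℝ) (τ 2) < (![θ 0, θ 1, -(θ 0 + θ 1)] : Fin 3 → ℝ) (τ 0) + 2 * π)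

include hC

/-- **Each chamber is measurable** (open). -/
theorem measurableSet_chamber_su3 (τ : Equiv.Perm (Fin 3)) : MeasurableSet (C τ) := by
  have hX : ∀ i : Fin 3, Measurable fun θ : Fin 2 → ℝ => (![θ 0, θ 1, -(θ 0 + θ 1)] : Fin 3 → ℝ) i :=
    fun i => (continuous_apply i).measurable.comp continuous_phases_su3.measurable
  have hset : C τ = {θ | (![θ 0, θ 1, -(θ 0 + θ 1)] : Fin 3 → ℝ) (τ 0) < (![θ 0, θ 1, -(θ 0 + θ 1)] : Fin 3 → ℝ) (τ 1)} ∩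
      ({θ | (![θ 0, θ 1, -(θ 0 + θ 1)] : Fin 3 → ℝ) (τ 1) < (![θ 0, θ 1, -(θ 0 + θ 1)] : Fin 3 → ℝ) (τ 2)} ∩
        {θ | (![θ 0, θ 1, -(θ 0 + θ 1)] : Fin 3 → ℝ) (τ 2) <
          (![θ 0, θ 1, -(θ 0 + θ 1)] : Fin 3 → ℝ) (τ 0) + 2 * π}) := by
    ext θ
    simp only [hC, Set.mem_inter_iff, Set.mem_setOf_eq]
  rw [hset]
  exact (measurableSet_lt (hX _) (hX _)).inter
    ((measurableSet_lt (hX _) (hX _)).inter (measurableSet_lt (hX _) ((hX _).add_const _)))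

/-- **The chambers are pairwise disjoint** (the chamber of a point is unique). -/
theorem pairwise_disjoint_chambers_su3 : Pairwise fun τ τ' => Disjoint (C τ) (C τ') := by
  intro τ τ' hne
  refine Set.disjoint_left.2 fun θ hθ hθ' => hne ?_
  obtain ⟨h0, h1, -⟩ := (hC τ θ).mp hθ
  obtain ⟨h0', h1', -⟩ := (hC τ' θ).mp hθ'
  exact perm_eq_of_alcoveChain h0 h1 h0' h1'

/-- **Off the walls, an integer translation lands in a chamber** (Algorithm 1 read on the free
phases). -/
theorem exists_intMul_add_mem_chamber_su3 {θ : Fin 2 → ℝ}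
    (hoff : ∀ i j : Fin 3, i ≠ j → ∀ k : ℤ,
      (![θ 0, θ 1, -(θ 0 + θ 1)] : Fin 3 → ℝ) i - (![θ 0, θ 1, -(θ 0 + θ 1)] : Fin 3 → ℝ) j ≠ k * (2 * π)) :
    ∃ (m : Fin 2 → ℤ) (τ : Equiv.Perm (Fin 3)), (fun k => (m k : ℝ) * (2 * π)) + θ ∈ C τ := by
  obtain ⟨m3, hm3, τ, h0, h1, h2⟩ :=
    exists_latticeShift_alcoveChain (by positivity : (0 : ℝ) < 2 * π) (sum_phases_su3 θ) hoff
  refine ⟨![m3 0, m3 1], τ, (hC τ _).mpr ?_⟩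
  -- the shifted eigen-phases are `x(θ) + 2π m3`
  have hm2 : -(m3 0 + m3 1) = m3 2 := by
    rw [Fin.sum_univ_three] at hm3
    linarith
  have hX : ∀ i : Fin 3,
      (![((fun k => ((![m3 0, m3 1] : Fin 2 → ℤ) k : ℝ) * (2 * π)) + θ) 0,
          ((fun k => ((![m3 0, m3 1] : Fin 2 → ℤ) k : ℝ) * (2 * π)) + θ) 1,
          -(((fun k => ((![m3 0, m3 1] : Fin 2 → ℤ) k : ℝ) * (2 * π)) + θ) 0 +
            ((fun k => ((![m3 0, m3 1] : Fin 2 → ℤ) k : ℝ) * (2 * π)) + θ) 1)] : Fin 3 → ℝ) i =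
        (![θ 0, θ 1, -(θ 0 + θ 1)] : Fin 3 → ℝ) i + (m3 i : ℝ) * (2 * π) := by
    intro i
    rw [phases_su3_intMul_add]
    congr 2
    fin_cases i
    · simp
    · simp
    · simp [hm2]
  rw [hX, hX, hX]
  exact ⟨h0, h1, h2⟩

/-- **Two points of the chambers differing by an integer translation are equal** (uniqueness of the
lattice shift). -/
theorem intMul_eq_zero_of_mem_chambers_su3 {θ : Fin 2 → ℝ} {m : Fin 2 → ℤ} {τ τ' : Equiv.Perm (Fin 3)}
    (hθ : θ ∈ C τ) (hθ' : (fun k => (m k : ℝ) * (2 * π)) + θ ∈ C τ') : m = 0 := by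
  obtain ⟨h0, h1, h2⟩ := (hC τ θ).mp hθ
  obtain ⟨h0', h1', h2'⟩ := (hC τ' _).mp hθ'
  have hy := abs_sub_lt_of_alcoveChain h0 h1 h2
  simp only [phases_su3_intMul_add] at h0' h1' h2'
  have hy' := abs_sub_lt_of_alcoveChain (y := fun i => (![θ 0, θ 1, -(θ 0 + θ 1)] : Fin 3 → ℝ) i +
    ((![m 0, m 1, -(m 0 + m 1)] : Fin 3 → ℤ) i : ℝ) * (2 * π)) h0' h1' h2'
  have hm3 := latticeShift_eq_zero_of_pairwise (by positivity : (0 : ℝ) < 2 * π) (sum_intVec_su3 m) hy hy'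
  funext k
  fin_cases k
  · simpa using congr_fun hm3 0
  · simpa using congr_fun hm3 1

/-- **The six chambers form a fundamental domain of the angle lattice `(2πℤ)²` acting on `ℝ²` by
translation** (Lebesgue measure): almost every point (off the null walls) has a lattice translate
in `⋃_τ C τ` by Algorithm 1, and distinct translates of `⋃_τ C τ` are disjoint by uniqueness of
the lattice shift. -/
theorem isAddFundamentalDomain_chambers_su3 :
    IsAddFundamentalDomain (AddSubgroup.pi Set.univ fun _ : Fin 2 => AddSubgroup.zmultiples (2 * π))
      (⋃ τ, C τ) (volume : Measure (Fin 2 → ℝ)) := by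
  refine IsAddFundamentalDomain.mk'' ?_ ?_ ?_ ?_
  · exact (MeasurableSet.iUnion (measurableSet_chamber_su3 hC)).nullMeasurableSet
  · -- cover a.e.: off the walls
    rw [ae_iff]
    refine measure_mono_null (fun θ hθ => ?_) volume_walls_su3_eq_zero
    simp only [Set.mem_setOf_eq] at hθ ⊢
    by_contra hoff
    push Not at hoff
    apply hθ
    obtain ⟨m, τ, hmem⟩ := exists_intMul_add_mem_chamber_su3 hC (θ := θ)
      (fun i j hij k hk => hoff i j hij k hk)
    exact ⟨⟨fun k => (m k : ℝ) * (2 * π), intMul_mem_latticePi _ m⟩, Set.mem_iUnion.2 ⟨τ, hmem⟩⟩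
  · -- distinct translates are disjoint
    intro g hg
    refine (Set.disjoint_left.2 fun x hx hx' => hg ?_).aedisjoint
    obtain ⟨d, hd, rfl⟩ := Set.mem_vadd_set.mp hx
    obtain ⟨τ, hdτ⟩ := Set.mem_iUnion.1 hd
    obtain ⟨τ', hxτ'⟩ := Set.mem_iUnion.1 hx'
    obtain ⟨m, hm⟩ := (mem_latticePi_iff_exists (g : Fin 2 → ℝ)).mp g.2
    rw [latticePi_vadd_eq, hm] at hxτ'
    have hm0 := intMul_eq_zero_of_mem_chambers_su3 hC hdτ hxτ'
    apply Subtype.ext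
    rw [hm, hm0]
    funext k
    simp
  · intro g
    exact (measurePreserving_add_left volume (g : Fin 2 → ℝ)).quasiMeasurePreserving

/-- **The chamber decomposition of the angle cube**: for every measurable `S ⊆ ℝ²` invariant under
the integer translations `θ ↦ 2πm + θ`, `m ∈ ℤ²`,
`Leb(S ∩ (−π, π]²) = Σ_{τ ∈ S₃} Leb(S ∩ C τ)`. -/
theorem volume_inter_cube_eq_sum_chambers_su3 {S : Set (Fin 2 → ℝ)} (hS : MeasurableSet S)
    (hinv : ∀ m : Fin 2 → ℤ, (fun θ : Fin 2 → ℝ => (fun k => (m k : ℝ) * (2 * π)) + θ) ⁻¹' S = S) :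
    volume (S ∩ Set.pi Set.univ fun _ : Fin 2 => Ioc (-π) π) = ∑ τ : Equiv.Perm (Fin 3), volume (S ∩ C τ) := by
  have h := volume_inter_cube_eq_sum_of_isAddFundamentalDomain (by positivity : (0 : ℝ) < 2 * π) (-π)
    (measurableSet_chamber_su3 hC) (pairwise_disjoint_chambers_su3 hC)
    (isAddFundamentalDomain_chambers_su3 hC) hS hinv
  rwa [show -π + 2 * π = π by ring] at h

end Chambers

end Summit.Ventures.LatticeQCDFlow.Exactness
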